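import Summits.CriticalPhenomena.PercolationContinuityZ3.Theorems.FK.FreeEdwardsSokalLROIdentity
import Summits.CriticalPhenomena.PercolationContinuityZ3.Theorems.FK.InfiniteVolumeGibbs
import Summits.CriticalPhenomena.PercolationContinuityZ3.Theorems.FK.OneArmLimit
import HarnessLib

/-!
# Grimmett's (5.32) at `q = 2`: `⟨σ_0σ_u⟩^∅_β → φ⁰_{p,2}(0 ↔ ∞)²` as `|u| → ∞`

fk-continuity build cell, row FO-03b⁗ (`--supports stmt-CriticalPhenomena-4575`, helper); builds on p205010
(kernel theorem, internal audit signed; external expert review pending). Sorry-free, standard axioms, no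
named facts, no new definitions.

The literal form of Grimmett 2006, Thm. (5.17) eq. (5.18) at `q = 2` — `½ θ⁰(p,2)² = lim_{|u|→∞}
{π_β(σ_0 = σ_u) - ½}`, i.e. (5.32) `φ⁰_{p,q}(0 ↔ u) → θ⁰(p,q)²` — for a free FK–Ising box limit `P` on `ℤ^d`
(`IsBoxLimit d false (1 - e^{-2β}) 2 P`, `β ≥ 0`), with `θ⁰` in the form `P(0 ↔ ∞)` (`= thetaFree`,
row FO-07) and the limit along the cofinite filter of `ℤ^d`:

* `FK.determinedBy_armEvent` — the translated one-arm event `{u ↔ ∂(u + Λ_n)}` is determined by the pairs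
  of sites of `u + Λ_n`;
* `FK.FKGibbs.real_inter_le_mul_add` — UNIFORM MIXING from the free/wired sandwich form of the DLR
  property (`FKGibbs`, `InfiniteVolumeGibbs.lean`; Grimmett 2006 Lemma (4.13) with (4.14)(b)): for an
  increasing event `A` determined by the lattice edges of `Λ` and an event `H` determined by finitely many
  pairs off `E_Λ`, `P(A ∩ H) ≤ P(A) P(H) + (P(A) - φ⁰_{Λ,p,q}(A))` — the error does not depend on `H`;
* `FK.IsBoxLimit.eventually_freePair_le` — the upper half of (5.32): for `ε > 0`, eventually (cofinite) in
  `u`, `⟨σ_0σ_u⟩^∅_β ≤ P(0 ↔ ∞)² + ε` (`{0 ↔ u} ⊆ {0 ↔ ∂Λ_n} ∩ {u ↔ ∂(u+Λ_n)}`, uniform mixing with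
  `Λ = Λ_m`, `φ⁰_{Λ_m}(0 ↔ ∂Λ_n) → P(0 ↔ ∂Λ_n)`, and `P(0 ↔ ∂Λ_n) ↓ P(0 ↔ ∞)` from `OneArmLimit.lean`);
* **`FK.IsBoxLimit.tendsto_freePair_cofinite`** — with positive association and a.s. uniqueness as well
  (the lower half `P(0 ↔ ∞)² ≤ ⟨σ_0σ_u⟩^∅_β`, `FreeEdwardsSokalTwoPoint.lean`):
  **`⟨σ_0σ_u⟩^∅_{β,0} → P(0 ↔ ∞)²` as `u → ∞` in `ℤ^d`.**

Hypotheses (`hG : FKGibbs`, `hT` shift invariance, `hPA` positive association, `huniq`) are the conclusions of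
the cell's `IsBoxLimit.fkGibbs`, `.measurePreserving_relabel_shift`, `.isPositivelyAssociated` and row FO-08
for `P = rcLimit d false p 2`.

References: G. Grimmett, *The Random-Cluster Model* (2006), Lemma (4.13), Lemma (4.14)(b), Thm. (4.19),
Cor. (4.23), Thm. (5.17) with the proof of (5.18), (5.32), p. 107 [Grimmett2006].
-/

noncomputable section

namespace Summit.CriticalPhenomena.PercolationContinuityZ3.Theorems

namespace FK

open MeasureTheory Finset Filter Topology Function
open Literature.Probability.LatticeModels Literature.Barriers.CriticalPhenomena
open Literature.Probability.Percolation

variable {d : ℕ}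

/-! ### Locality of the translated one-arm event -/

/-- The translated one-arm event `{u ↔ ∂(u + Λ_n) inside u + Λ_n}` is determined by the pairs of sites of
`u + Λ_n` (`shiftedBox u n`). [cite: DuminilCopinTassionEM2016, §2.1 (the one-arm event is measurable w.r.t. the box)] -/
theorem determinedBy_armEvent (u : Site d) (n : ℕ) :
    DeterminedBy (DCT16.armEvent u n) (↑(shiftedBox u n).sym2 : Set (Sym2 (Site d))) := by
  have h : DCT16.armEvent u n = ⋃ a : {a : Site d // a - u ∈ innerBoundary (zdGraph d) (box d n)},
      openConnIn {z : Site d | z - u ∈ box d n} u a.1 := by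
    ext ω
    simp only [DCT16.armEvent, Set.mem_setOf_eq, Set.mem_iUnion, Subtype.exists, exists_prop]
  rw [h]
  refine DeterminedBy.iUnion fun a => DCT16.determinedBy_openConnIn _ u a.1 ?_
  intro e he
  induction e using Sym2.ind with
  | h x y =>
    rw [Set.mk_mem_sym2_iff] at he
    rw [Finset.coe_sym2, Set.mk_mem_sym2_iff]
    exact ⟨Finset.mem_coe.2 (mem_shiftedBox_iff.2 he.1), Finset.mem_coe.2 (mem_shiftedBox_iff.2 he.2)⟩

/-- The pairs of `u + Λ_n` avoid the lattice edges of `Λ_m` as soon as `u + Λ_n` misses `Λ_m`.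
[folklore] -/
theorem disjoint_sym2_shiftedBox_edgesIn {u : Site d} {n m : ℕ} (h : ∀ z ∈ shiftedBox u n, z ∉ box d m) :
    Disjoint (↑(shiftedBox u n).sym2 : Set (Sym2 (Site d))) ↑(edgesIn (zdGraph d) (box d m)) := by
  rw [Set.disjoint_left]
  intro e he he'
  rw [Finset.mem_coe, Finset.mem_sym2_iff] at he
  rw [Finset.mem_coe, mem_edgesIn_iff] at he'
  induction e using Sym2.ind with
  | h a b => exact h a (he a (Sym2.mem_mk_left a b)) (he'.2 a (Sym2.mem_mk_left a b))

/-- If `u ∉ Λ_{m+n}` then `u + Λ_n` misses `Λ_m`. [folklore] -/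
theorem shiftedBox_notMem_box_of_notMem {u : Site d} {n m : ℕ} (hu : u ∉ box d (m + n)) :
    ∀ z ∈ shiftedBox u n, z ∉ box d m := by
  intro z hz hzm
  rw [mem_shiftedBox_iff, mem_box] at hz
  rw [mem_box] at hzm
  apply hu
  rw [mem_box]
  intro i
  have h1 := hz i
  have h2 := hzm i
  simp only [Pi.sub_apply] at h1
  push_cast
  omega

/-! ### Uniform mixing from the free/wired sandwich -/

/-- **Uniform mixing for FK Gibbs measures** (from the DLR sandwich, Grimmett 2006 Lemma (4.13) with
(4.14)(b); the first display of the proof of Thm. (4.19)(d)/(4.23)): for an increasing event `A` determined by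
the lattice edges of the finite region `Λ` and an event `H` determined by a finite set of pairs off `E_Λ`,
`P(A ∩ H) ≤ P(A) P(H) + (P(A) - φ⁰_{Λ,p,q}(A))`. Proof: the lower sandwich applied to `Hᶜ` gives
`P(A ∩ Hᶜ) ≥ φ⁰_Λ(A) P(Hᶜ)`. [cite: Grimmett2006, Lemma (4.13), Lemma (4.14)(b) and Cor. (4.23)] -/
theorem FKGibbs.real_inter_le_mul_add {p q : ℝ} {P : Measure (BondConfig (Site d))} (hG : FKGibbs d p q P)
    (Λ : Finset (Site d)) {A H : Set (BondConfig (Site d))} (T : Finset (Sym2 (Site d)))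
    (hA : IsUpperSet A) (hAΛ : DeterminedBy A ↑(edgesIn (zdGraph d) Λ))
    (hT : Disjoint (↑T : Set (Sym2 (Site d))) ↑(edgesIn (zdGraph d) Λ)) (hH : DeterminedBy H ↑T)
    (hHm : MeasurableSet H) :
    P.real (A ∩ H) ≤ P.real A * P.real H + (P.real A - regionFreeReal d p q Λ A) := by
  haveI := hG.isProbabilityMeasure
  have hHc : DeterminedBy Hᶜ ↑T := by
    rw [determinedBy_iff] at hH ⊢
    exact fun ω ω' h => not_congr (hH ω ω' h)
  have h1 := hG.free_mul_le Λ T hA hAΛ hT hHc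
  -- `P(A ∩ Hᶜ) = P(A) - P(A ∩ H)` and `P(Hᶜ) = 1 - P(H)`
  have h2 : P.real (A ∩ Hᶜ) = P.real A - P.real (A ∩ H) := by
    have h0 : P.real (A ∩ H) + P.real (A \ H) = P.real A := measureReal_inter_add_sdiff (s := A) hHm
    rw [Set.sdiff_eq_compl_inter, Set.inter_comm Hᶜ A] at h0
    linarith
  have h3 : P.real Hᶜ = 1 - P.real H := probReal_compl_eq_one_sub hHm
  rw [h2, h3] at h1
  have h4 : regionFreeReal d p q Λ A ≤ P.real A := hG.regionFreeReal_le Λ hA hAΛ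
  have h6 : regionFreeReal d p q Λ A * P.real H ≤ P.real A * P.real H :=
    mul_le_mul_of_nonneg_right h4 measureReal_nonneg
  nlinarith [h1, h6]

section Pointwise

variable {β : ℝ} {P : Measure (BondConfig (Site d))}

/-- **The upper half of (5.32), pointwise**: for a free FK–Ising box limit `P` on `ℤ^d` (`β ≥ 0`)
which is an FK Gibbs measure (`hG`, the cell's `IsBoxLimit.fkGibbs`) and translation invariant, and every
`ε > 0`: for all but finitely many `u`, `⟨σ_0σ_u⟩^∅_{β,0} ≤ P(0 ↔ ∞)² + ε`. Proof (Grimmett 2006, proof of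
(5.18), p. 107): `⟨σ_0σ_u⟩^∅ = P(0 ↔ u) ≤ P({0 ↔ ∂Λ_n} ∩ {u ↔ ∂(u + Λ_n)}) ≤ P(0 ↔ ∂Λ_n) P(u ↔ ∂(u+Λ_n)) +
(P(0 ↔ ∂Λ_n) - φ⁰_{Λ_m}(0 ↔ ∂Λ_n))` once `u + Λ_n` misses `Λ_m` (uniform mixing), with
`P(u ↔ ∂(u+Λ_n)) = P(0 ↔ ∂Λ_n)` close to `P(0 ↔ ∞)` and `φ⁰_{Λ_m}(0 ↔ ∂Λ_n)` close to `P(0 ↔ ∂Λ_n)`.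
[cite: Grimmett2006, Thm. (5.17), proof of (5.18), (5.32), p. 107, with Cor. (4.23)] -/
theorem IsBoxLimit.eventually_freePair_le (hP : IsBoxLimit d false (fkIsingParam β) 2 P)
    (hβ : 0 ≤ β) (hG : FKGibbs d (fkIsingParam β) 2 P)
    (hT : ∀ v : Site d, MeasurePreserving (BondConfig.relabel (sym2Equiv (Site.shift v))) P P)
    {ε : ℝ} (hε : 0 < ε) :
    ∀ᶠ u in cofinite, freePair d β 0 u ≤ P.real (percolatesAt (0 : Site d)) ^ 2 + ε := by
  haveI := hP.isProbabilityMeasure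
  have hp : fkIsingParam β ∈ Set.Icc (0 : ℝ) 1 := fkIsingParam_mem_Icc hβ
  have hS : ∀ᵐ ω ∂P, ω ⊆ (zdGraph d).edgeSet := hG.ae_subset_edgeSet
  set θ : ℝ := P.real (percolatesAt (0 : Site d)) with hθ
  have hθ1 : θ ≤ 1 := measureReal_le_one
  -- `δ` with `4δ ≤ ε`, `δ ≤ 1`
  set δ : ℝ := min (ε / 4) 1 with hδ
  have hδ0 : 0 < δ := lt_min (by linarith) one_pos
  have hδε : 4 * δ ≤ ε := by have := min_le_left (ε / 4) 1; linarith
  have hδ1 : δ ≤ 1 := min_le_right _ _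
  -- a level `n` with `P(0 ↔ ∂Λ_n) < θ + δ`
  obtain ⟨n, hn⟩ := exists_real_siteToBoundary_lt (P := P) hS hδ0
  set A : Set (BondConfig (Site d)) := siteToBoundary d n with hA
  -- its lattice version `A' = {ω | ω ∩ E(Λ_n) ∈ A}`, determined by `E(Λ_n)`, equal to `A` a.s.
  set E : Set (Sym2 (Site d)) := ↑(edgesIn (zdGraph d) (box d n)) with hE
  set A' : Set (BondConfig (Site d)) := (fun ω => ω ∩ E) ⁻¹' A with hA'
  have hA'det : DeterminedBy A' E := determinedBy_preimage_inter E A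
  have hA'up : IsUpperSet A' :=
    (DCT16.isUpperSet_siteToBoundary d n).preimage fun _ _ h => Set.inter_subset_inter_left E h
  have hA'loc : IsLocalEvent A' := ⟨edgesIn (zdGraph d) (box d n), hA'det⟩
  have hA'm : MeasurableSet A' := measurableSet_of_isLocalEvent_holds hA'loc
  have hAm : MeasurableSet A := DCT16.measurableSet_siteToBoundary d n
  have hAA' : ∀ ω : BondConfig (Site d), ω ⊆ (zdGraph d).edgeSet → (ω ∈ A' ↔ ω ∈ A) := by
    intro ω hω
    refine (determinedBy_iff _ _).1 (DCT16.determinedBy_siteToBoundary d n) _ _ ?_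
    ext e
    simp only [Set.mem_inter_iff, hE, Finset.mem_coe, mem_edgesIn_iff, Finset.mem_sym2_iff]
    constructor
    · rintro ⟨⟨he, -⟩, hs⟩; exact ⟨he, hs⟩
    · rintro ⟨he, hs⟩; exact ⟨⟨he, hω he, fun x hx => hs x hx⟩, hs⟩
  have hAeq : P.real A' = P.real A :=
    measureReal_congr (hS.mono fun ω hω => by
      show (ω ∈ A') = (ω ∈ A)
      exact propext (hAA' ω hω))
  -- a box `Λ_m`, `m ≥ n`, with `P(A') - φ⁰_{Λ_m}(A') < δ`
  have hconv : Tendsto (fun m : ℕ => (rcBoxLaw d false (fkIsingParam β) 2 m).real A') atTop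
      (𝓝 (P.real A')) :=
    (ENNReal.tendsto_toReal (measure_ne_top P A')).comp (hP.tendsto_of_isLocalEvent A' hA'loc)
  obtain ⟨m, hmn, hm⟩ : ∃ m, n ≤ m ∧ P.real A' - (rcBoxLaw d false (fkIsingParam β) 2 m).real A' < δ := by
    obtain ⟨M, hM⟩ := Metric.tendsto_atTop.1 hconv δ hδ0
    refine ⟨max M n, le_max_right _ _, ?_⟩
    have h := hM (max M n) (le_max_left _ _)
    rw [Real.dist_eq, abs_lt] at h
    linarith
  -- `A'` is determined by the edges of the larger box `Λ_m` as well
  have hA'detm : DeterminedBy A' ↑(edgesIn (zdGraph d) (box d m)) :=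
    hA'det.mono (by
      rw [hE]; exact Finset.coe_subset.2 fun e he => by
        rw [mem_edgesIn_iff] at he ⊢; exact ⟨he.1, fun x hx => box_mono d hmn (he.2 x hx)⟩)
  have hfree : regionFreeReal d (fkIsingParam β) 2 (box d m) A' =
      (rcBoxLaw d false (fkIsingParam β) 2 m).real A' := regionFreeReal_box _ _ m hA'm
  -- the null set of non-lattice configurations
  have hnull : P.real {ω : BondConfig (Site d) | ¬ω ⊆ (zdGraph d).edgeSet} = 0 := by
    rw [measureReal_def, show P {ω : BondConfig (Site d) | ¬ω ⊆ (zdGraph d).edgeSet} = 0 from ae_iff.1 hS,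
      ENNReal.toReal_zero]
  -- now the estimate, for `u ∉ Λ_{m+n}`
  filter_upwards [(box d (m + n)).finite_toSet.compl_mem_cofinite] with u hu
  have hu' : u ∉ box d (m + n) := fun h => hu (Finset.mem_coe.2 h)
  have hun : u ∉ box d n := fun h => hu' (box_mono d (Nat.le_add_left n m) h)
  have hnegun : -u ∉ box d n := by
    intro h; apply hun; rw [mem_box] at h ⊢; intro i; have := h i; simp only [Pi.neg_apply] at this; omega
  set H : Set (BondConfig (Site d)) := DCT16.armEvent u n with hH
  have hHdet : DeterminedBy H ↑(shiftedBox u n).sym2 := determinedBy_armEvent u n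
  have hHm : MeasurableSet H := measurableSet_of_isLocalEvent_holds ⟨_, hHdet⟩
  have hTdisj : Disjoint (↑(shiftedBox u n).sym2 : Set (Sym2 (Site d))) ↑(edgesIn (zdGraph d) (box d m)) :=
    disjoint_sym2_shiftedBox_edgesIn (shiftedBox_notMem_box_of_notMem hu')
  -- `P(H) = P(A)` by translation invariance
  have hHA : P.real H = P.real A := by
    rw [hH, ← DCT16.preimage_shift_siteToBoundary u n, measureReal_def, measureReal_def,
      (hT (-u)).measure_preimage hAm.nullMeasurableSet]
  -- `⟨σ_0σ_u⟩ = P(0 ↔ u) ≤ P(A ∩ H) = P(A' ∩ H)`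
  have hstep1 : freePair d β 0 u ≤ P.real (A' ∩ H) := by
    rw [← hP.real_openConn_eq_freePair hβ 0 u]
    calc P.real (openConn 0 u)
        ≤ P.real (A' ∩ H ∪ {ω : BondConfig (Site d) | ¬ω ⊆ (zdGraph d).edgeSet}) := by
          refine measureReal_mono fun ω hω => ?_
          by_cases hωE : ω ⊆ (zdGraph d).edgeSet
          · have h := mem_armEvent_inter_of_mem_openConn hωE (n := n)
              (by rwa [sub_zero]) (by rwa [zero_sub]) hω
            rw [DCT16.armEvent_zero] at h
            exact Or.inl ⟨(hAA' ω hωE).2 h.1, h.2⟩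
          · exact Or.inr hωE
      _ ≤ P.real (A' ∩ H) + P.real {ω : BondConfig (Site d) | ¬ω ⊆ (zdGraph d).edgeSet} :=
          measureReal_union_le _ _
      _ = P.real (A' ∩ H) := by rw [hnull, add_zero]
  -- uniform mixing
  have hstep2 : P.real (A' ∩ H) ≤ P.real A' * P.real H +
      (P.real A' - regionFreeReal d (fkIsingParam β) 2 (box d m) A') :=
    hG.real_inter_le_mul_add (box d m) _ hA'up hA'detm hTdisj hHdet hHm
  rw [hfree, hAeq, hHA] at hstep2
  -- collect: `P(A)² + δ ≤ (θ + δ)² + δ ≤ θ² + 4δ ≤ θ² + ε`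
  have hAθ : P.real A < θ + δ := hn
  have hA0 : 0 ≤ P.real A := measureReal_nonneg
  have hθ0 : 0 ≤ θ := measureReal_nonneg
  rw [hAeq] at hm
  nlinarith [hstep1, hstep2, hm, hAθ, hA0, hθ0, hθ1, hδ1, hδε]

/-- **Grimmett's (5.32) at `q = 2`, pointwise: `⟨σ_0σ_u⟩^∅_{β,0} → φ⁰_{p,2}(0 ↔ ∞)²` as `u → ∞` in `ℤ^d`**
(`p = 1 - e^{-2β}`, `β ≥ 0`), for a free FK–Ising box limit `P` which is an FK Gibbs measure,
translation invariant, positively associated, with a.s. at most one infinite cluster (all four proved for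
`φ⁰_{p,2}` in the cell's construction files / row FO-08). Upper half: `eventually_freePair_le` (uniform mixing);
lower half: `P(0 ↔ ∞)² ≤ ⟨σ_0σ_u⟩^∅_β` for every `u` (`sq_real_percolatesAt_le_freePair`: uniqueness + FKG).
Equivalently `½ θ⁰(p,2)² = lim_{|u|→∞} {π_β(σ_0 = σ_u) - ½}`, Thm. (5.17) eq. (5.18), once `P(0 ↔ ∞) = θ⁰(p,2)`
(row FO-07). [cite: Grimmett2006, Thm. (5.17), eq. (5.18) and its proof, (5.32), p. 107] -/
theorem IsBoxLimit.tendsto_freePair_cofinite (hP : IsBoxLimit d false (fkIsingParam β) 2 P)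
    (hβ : 0 ≤ β) (hG : FKGibbs d (fkIsingParam β) 2 P) (hPA : IsPositivelyAssociated P)
    (hT : ∀ v : Site d, MeasurePreserving (BondConfig.relabel (sym2Equiv (Site.shift v))) P P)
    (huniq : ∀ᵐ ω ∂P, numInfiniteClusters ω ≤ 1) :
    Tendsto (fun u : Site d => freePair d β 0 u) cofinite (𝓝 (P.real (percolatesAt (0 : Site d)) ^ 2)) := by
  set θ2 : ℝ := P.real (percolatesAt (0 : Site d)) ^ 2 with hθ2
  have hlow : ∀ u, θ2 ≤ freePair d β 0 u := fun u => hP.sq_real_percolatesAt_le_freePair hβ hPA hT huniq 0 u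
  rw [Metric.tendsto_nhds]
  intro ε hε
  filter_upwards [hP.eventually_freePair_le hβ hG hT (half_pos hε)] with u hu
  rw [Real.dist_eq, abs_lt]
  constructor <;> linarith [hlow u]

end Pointwise

end FK

end Summit.CriticalPhenomena.PercolationContinuityZ3.Theorems

end
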